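import Mathlib.Analysis.InnerProductSpace.PiL2
import Literature.Geometry.DiscreteGeometry.KissingPatterns
import Literature.Geometry.DiscreteGeometry.KissingNumberThreeProofs
import HarnessLib

/-!
# The E2 interface of the per-ball general-filling plan: exact-only own patterns are unsaturable

HONEST FRAMING. Part of the venture `Summits/Ventures/Crystal3D` (cell `crystal3d-full`), helper
`--supports` the crux `GenericWallFloor` (stmt-Ventures-19480) of `route-Ventures-StickyWulffConstant`,
registered line `WallLedgerG` (planner cf-p1 gen 16/22), open stub `stub_twoSlabAdhesion : TwoSlabAdhesion`
(THE CRUX of the line: the GENERAL-FILLING step).  This file is the planner's E2 INTERFACE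
(cf-p1 gen 22, `HOME/cf-p1/route/lines/wall/ExactOnlySketch.lean`, evidence #35 on the item; ROUTE.md
§80(6)–(9)), landed verbatim up to the namespace so that the E1 certification campaign (eng), the E3
coverage flow and the kernel witnesses against over-optimistic patterns (lit g11's twisted square, SLOTEX
row A12-1743) have ONE set of names to talk to.

* `IsKissingAround c S` — `S` is a kissing arrangement around the centre `c` (unit distance to `c`,
  pairwise distance `≥ 1`).
* `IsClosePackedDozenAt c D` — `D` is a close-packed dozen around `c`: a linear-isometric image of the
  cuboctahedron `fccKissingPattern` or of the anticuboctahedron `hcpKissingPattern`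
  (`Literature/Geometry/DiscreteGeometry/KissingPatterns.lean`), translated to `c`.
* `ExactOnly c O` — EVERY kissing completion of the own pattern `O` to twelve balls around `c` is a
  close-packed dozen.  This is what E1 certifies per orbit (SLOTEX, cf-p1 ROUTE §80(6): fcc patterns with
  `|O| ≥ 7`, fcc `|O| = 6` except orbits `111`/`924`, hcp `|O| ≥ 9`, hcp `8` except `1743`, hcp `7` except
  `719/1735/1739`); `ExactOnly.mono`: monotone in `O`.
* `SingleDozen c slots O` — the only close-packed dozen around `c` containing `O` is `slots`
  (classified in the sequel `…GenericWallFloorSlotDozens`: `O` non-coplanar and not inside a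
  «hexagon + one polar triple» nine-set of the slot dozen).
* `unsaturated_of_exactOnly` — E2, the per-ball step: in a `1`-separated configuration `X`, a ball `b`
  whose occupied slots form an exact-only, single-dozen pattern and which has an EMPTY slot has at most
  eleven contacts (kissing number twelve: tree theorem `musin2006_kissing_three_holds`).

WHAT THIS IS NOT: no certification of any pattern (E1), no coverage flow (E3), not the stub; rung F-C1
not moved.
-/

noncomputable section

namespace Summit.Ventures.Crystal3D.Theorems

open Literature.Geometry.DiscreteGeometry

/-- `S` is a kissing arrangement around `c`: unit distance to `c`, pairwise distance `≥ 1`. -/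
def IsKissingAround (c : EuclideanSpace ℝ (Fin 3)) (S : Finset (EuclideanSpace ℝ (Fin 3))) : Prop :=
  (∀ s ∈ S, dist c s = 1) ∧ (∀ s ∈ S, ∀ t ∈ S, s ≠ t → 1 ≤ dist s t)

/-- `D` is a close-packed dozen around `c`: a linear-isometric image of the fcc or of the hcp unit
pattern, translated to `c`. -/
def IsClosePackedDozenAt (c : EuclideanSpace ℝ (Fin 3)) (D : Finset (EuclideanSpace ℝ (Fin 3))) : Prop :=
  ∃ A : EuclideanSpace ℝ (Fin 3) →ₗᵢ[ℝ] EuclideanSpace ℝ (Fin 3),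
    (↑D : Set (EuclideanSpace ℝ (Fin 3))) =
        (fun p => A p + c) '' (↑fccKissingPattern : Set (EuclideanSpace ℝ (Fin 3))) ∨
      (↑D : Set (EuclideanSpace ℝ (Fin 3))) =
        (fun p => A p + c) '' (↑hcpKissingPattern : Set (EuclideanSpace ℝ (Fin 3)))

/-- The own-pattern `O` around `c` is EXACT-ONLY: every kissing completion of `O` to twelve balls is
a close-packed dozen.  (E1 certifies this per orbit; the twisted-square dozen of
`…GenericWallFloorTwistedSquare` refutes it for the hcp patterns `1743/719/1735/1739`.) -/
def ExactOnly (c : EuclideanSpace ℝ (Fin 3)) (O : Finset (EuclideanSpace ℝ (Fin 3))) : Prop :=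
  ∀ N : Finset (EuclideanSpace ℝ (Fin 3)), O ⊆ N → N.card = 12 → IsKissingAround c N →
    IsClosePackedDozenAt c N

/-- Exact-only is monotone under enlarging the own-pattern (used by the coverage flow: a ball whose
lower hemisphere is occupied inherits certification from the hemisphere pattern). -/
theorem ExactOnly.mono {c : EuclideanSpace ℝ (Fin 3)} {O O' : Finset (EuclideanSpace ℝ (Fin 3))}
    (h : ExactOnly c O) (hsub : O ⊆ O') : ExactOnly c O' :=
  fun N hN hcard hk => h N (hsub.trans hN) hcard hk

/-- `O` is SINGLE-DOZEN w.r.t. the slot set `slots` (the twelve lattice slots of the centre): the only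
close-packed dozen around `c` containing `O` is `slots`.  (Lattice algebra per pattern; fails exactly
for the coplanar patterns and for the patterns inside «hexagon + one polar triple» of a `{111}` family,
which admit the twin dozen — sequel `…GenericWallFloorSlotDozens`.) -/
def SingleDozen (c : EuclideanSpace ℝ (Fin 3)) (slots O : Finset (EuclideanSpace ℝ (Fin 3))) : Prop :=
  ∀ D : Finset (EuclideanSpace ℝ (Fin 3)), IsClosePackedDozenAt c D → O ⊆ D → D = slots

/-- **Kissing number twelve, Finset form around an arbitrary centre.**  A kissing arrangement around
`b` has at most twelve members (tree theorem `musin2006_kissing_three_holds`, translated by `−b`). -/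
theorem IsKissingAround.card_le_twelve {b : EuclideanSpace ℝ (Fin 3)}
    {N : Finset (EuclideanSpace ℝ (Fin 3))} (hN : IsKissingAround b N) : N.card ≤ 12 := by
  classical
  have hk : musin2006_kissing_three := musin2006_kissing_three_holds
  have hinj : Function.Injective fun y : EuclideanSpace ℝ (Fin 3) => y - b :=
    fun a c hac => sub_left_injective hac
  rw [← Finset.card_image_of_injective N hinj]
  refine hk _ (fun v hv => ?_) (fun v hv w hw hvw => ?_)
  · obtain ⟨y, hy, rfl⟩ := Finset.mem_image.mp hv
    have h := hN.1 y hy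
    rw [← dist_eq_norm, dist_comm]; exact h
  · obtain ⟨y, hy, rfl⟩ := Finset.mem_image.mp hv
    obtain ⟨z, hz, rfl⟩ := Finset.mem_image.mp hw
    have hyz : y ≠ z := fun h => hvw (by simp [h])
    simpa [dist_eq_norm] using hN.2 y hy z hz hyz

/-- **E2, the per-ball step.**  In a `1`-separated configuration `X`, a ball `b` all of whose contacts on
its slots form an exact-only, single-dozen pattern, and which has an EMPTY slot, is unsaturated: it has
at most eleven contacts. -/
theorem unsaturated_of_exactOnly (X : Finset (EuclideanSpace ℝ (Fin 3)))
    (hX : ∀ p ∈ X, ∀ q ∈ X, p ≠ q → 1 ≤ dist p q)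
    (b : EuclideanSpace ℝ (Fin 3)) (slots : Finset (EuclideanSpace ℝ (Fin 3)))
    (hslots : ∀ s ∈ slots, dist b s = 1)
    (hO : ExactOnly b (slots ∩ X))
    (h1 : SingleDozen b slots (slots ∩ X))
    (hempty : ∃ s ∈ slots, s ∉ X) :
    (X.filter fun q => dist b q = 1).card ≤ 11 := by
  classical
  by_contra hlt
  push Not at hlt
  set N := X.filter fun q => dist b q = 1 with hN
  have hkiss : IsKissingAround b N := by
    refine ⟨fun s hs => (Finset.mem_filter.mp hs).2, fun s hs t ht hst => ?_⟩
    exact hX s (Finset.mem_filter.mp hs).1 t (Finset.mem_filter.mp ht).1 hst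
  have hle : N.card ≤ 12 := hkiss.card_le_twelve
  have hcard : N.card = 12 := le_antisymm hle (by omega)
  have hsub : slots ∩ X ⊆ N := by
    intro s hs
    obtain ⟨hs1, hs2⟩ := Finset.mem_inter.mp hs
    exact Finset.mem_filter.mpr ⟨hs2, hslots s hs1⟩
  have hD := hO N hsub hcard hkiss
  have hEq : N = slots := h1 N hD hsub
  obtain ⟨s, hs, hsX⟩ := hempty
  have : s ∈ N := hEq ▸ hs
  exact hsX (Finset.mem_filter.mp this).1

/-- **E2 with the own part read off the contact shell.**  Same conclusion when the exact-only /
single-dozen hypotheses are stated for the own part `O` of the contact shell directly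
(`O = slots ∩ X` is the typical instance; any `O ⊆ N(b)` with the two properties will do). -/
theorem unsaturated_of_exactOnly' (X : Finset (EuclideanSpace ℝ (Fin 3)))
    (hX : ∀ p ∈ X, ∀ q ∈ X, p ≠ q → 1 ≤ dist p q)
    (b : EuclideanSpace ℝ (Fin 3)) (slots O : Finset (EuclideanSpace ℝ (Fin 3)))
    (hOsub : O ⊆ X.filter fun q => dist b q = 1)
    (hO : ExactOnly b O) (h1 : SingleDozen b slots O)
    (hempty : ∃ s ∈ slots, s ∉ X) :
    (X.filter fun q => dist b q = 1).card ≤ 11 := by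
  classical
  by_contra hlt
  push Not at hlt
  set N := X.filter fun q => dist b q = 1 with hN
  have hkiss : IsKissingAround b N := by
    refine ⟨fun s hs => (Finset.mem_filter.mp hs).2, fun s hs t ht hst => ?_⟩
    exact hX s (Finset.mem_filter.mp hs).1 t (Finset.mem_filter.mp ht).1 hst
  have hcard : N.card = 12 := le_antisymm hkiss.card_le_twelve (by omega)
  have hEq : N = slots := h1 N (hO N hOsub hcard hkiss) hOsub
  obtain ⟨s, hs, hsX⟩ := hempty
  have : s ∈ N := hEq ▸ hs
  exact hsX (Finset.mem_filter.mp this).1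

end Summit.Ventures.Crystal3D.Theorems

end
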